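import Literature.NumberTheory.GaloisRepresentations.IdeleClassGroupLimit
import Literature.NumberTheory.GaloisRepresentations.ChebotarevCyclicProofs
import Mathlib.FieldTheory.IsAlgClosed.Basic
import HarnessLib

/-!
# Every finite Galois extension of a layer is realised inside `F̄`: for a layer `E ⊆ F̄` and a finite Galois
# `M'/F` containing `E`, there is a layer `M ⊇ E` of `F̄` with `M ≃ M'` over `E` (Galois theory;
# Tate, C–F VII §11.1 — the finite layers `E ⊆ K̄`)

Topic `NumberTheory/GaloisRepresentations`; namespace `Literature.NumberTheory.GaloisRepresentations.IdeleClassBar.GalLayer`.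
Theorems only; no definition, no named fact, no instance, no `sorry`.  Sequel to `IdeleClassGroupLimit.lean` (door-c5
g15: `GalLayer F = {E ⊆ F̄ finite Galois over F}`, `GalLayer.algebraOfLE`).

THE POINT.  The cell's finite-layer theorems produce bigger layers as abstract TYPES (`CyclotomicField ℓ E`,
compositum types, …); the colimit arguments over `Γ_F` (door-c4's (d) / the relative layers of door-c6 g15) run
over the layers INSIDE `F̄`.  This file bridges the two: **`exists_ge_finrank_eq`** — for `E : GalLayer F` and any
`M' : Type` with `F ⊆ E ⊆ M'` a tower (`IsScalarTower F E M'`), `M'/F` finite Galois, there is `M : GalLayer F` with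
`E ≤ M` and `[M : E] = [M' : E]` (for the inclusion algebra `algebraOfLE`); in fact `M ≃ₐ[F] M'`.  Proof: embed `M'`
into the algebraically closed `F̄` over `E` (Mathlib `IsAlgClosed.lift`), take the field range (`AlgHom.fieldRange`,
`AlgHom.equivFieldRange`), transport `IsGalois`, and compare degrees along the `E`-linear corestriction.
Corollary **`exists_ge_finrank_dvd`**: every layer `E` has a layer `M ≥ E` with `[E : F] ∣ [M : E]` (the cyclotomic
layer `E(ζ_ℓ)`, tree `exists_prime_dvd_finrank_cyclotomicField` + `isGalois_cyclotomicField_of_isGalois`), the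
input of Milne ADT I Lemma 1.9 / Harari Lemma 16.20 ("the transition maps of `lim→ Hʳ(Gal(E/F), C_E)` are
eventually zero") over `Γ_F`.

Written for Route A of the Poitou–Tate programme of crux `AnticycControlAdditiveK` (cell bsd-schneider, item 19295), seat
door-c6 gen 15.  HONEST FRAMING: field theory bookkeeping only.

## References
* J. W. S. Cassels, A. Fröhlich (eds.), *Algebraic Number Theory* (1967), Ch. VII (J. Tate) §11.1 (the layers
  `E ⊆ K̄`). [CasselsFrohlichANT1967]
* J. S. Milne, *Arithmetic Duality Theorems* (2nd ed. 2006), I §1, Lemma 1.9 (proof). [MilneADT2006]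
* D. Harari, *Galois Cohomology and Class Field Theory* (2020), Remark 16.3, Lemma 16.20. [Harari2020]
-/

noncomputable section

open Field (absoluteGaloisGroup)
open scoped Classical

namespace Literature.NumberTheory.GaloisRepresentations

namespace IdeleClassBar

namespace GalLayer

variable {F : Type} [Field F]

/-- **Every finite Galois `M'/F` containing the layer `E` is realised as a layer `M ⊇ E` of `F̄` with the same
degree over `E`** (embed `M'` into `F̄` over `E` by `IsAlgClosed.lift` and take the field range).
[cite: CasselsFrohlichANT1967, Ch. VII §11.1] -/
theorem exists_ge_finrank_eq (E : GalLayer F) (M' : Type) [Field M'] [Algebra F M'] [Algebra E.1 M']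
    [IsScalarTower F E.1 M'] [FiniteDimensional F M'] [IsGalois F M'] :
    ∃ (M : GalLayer F) (h : E ≤ M), (letI := algebraOfLE h; Module.finrank E.1 M.1) = Module.finrank E.1 M' := by
  haveI : FiniteDimensional E.1 M' := Module.Finite.of_restrictScalars_finite F E.1 M'
  haveI : Algebra.IsAlgebraic E.1 M' := Algebra.IsAlgebraic.of_finite E.1 M'
  -- embed `M'` into `F̄` over `E`
  let φ : M' →ₐ[E.1] AlgebraicClosure F := IsAlgClosed.lift
  let ψ : M' →ₐ[F] AlgebraicClosure F := φ.restrictScalars F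
  let M₀ : IntermediateField F (AlgebraicClosure F) := ψ.fieldRange
  let e : M' ≃ₐ[F] M₀ := ψ.equivFieldRange
  haveI : FiniteDimensional F M₀ := LinearEquiv.finiteDimensional e.toLinearEquiv
  haveI : IsGalois F M₀ := IsGalois.of_algEquiv e
  let M : GalLayer F := ⟨M₀, inferInstance, inferInstance⟩
  -- `E ≤ M`: `x = φ (algebraMap E M' x)` lies in the range
  have hle : E ≤ M := fun x hx => by
    refine (AlgHom.mem_fieldRange (f := ψ)).2 ⟨algebraMap E.1 M' ⟨x, hx⟩, ?_⟩
    change φ (algebraMap E.1 M' ⟨x, hx⟩) = x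
    rw [AlgHom.commutes]
    rfl
  refine ⟨M, hle, ?_⟩
  letI := algebraOfLE hle
  -- the corestriction `M' → M` is `E`-linear and bijective
  let l : M' →ₗ[E.1] M.1 :=
    { toFun := fun m => ⟨ψ m, (AlgHom.mem_fieldRange (f := ψ)).2 ⟨m, rfl⟩⟩
      map_add' := fun a b => Subtype.ext (map_add ψ a b)
      map_smul' := fun a m => Subtype.ext (by
        change φ (a • m) = ((a : E.1) : AlgebraicClosure F) * φ m
        rw [Algebra.smul_def, map_mul, AlgHom.commutes]
        rfl) }
  have hl : Function.Bijective l := by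
    refine ⟨fun a b hab => ψ.injective (congrArg Subtype.val hab), fun y => ?_⟩
    obtain ⟨m, hm⟩ := (AlgHom.mem_fieldRange (f := ψ)).1 y.2
    exact ⟨m, Subtype.ext hm⟩
  exact ((LinearEquiv.ofBijective l hl).finrank_eq).symm

/-- **Every layer `E` has a layer `M ⊇ E` with `[E : F] ∣ [M : E]`** — the cyclotomic layer `E(ζ_ℓ) ⊆ F̄` for a prime
`ℓ` with `[E : F] ∣ [E(ζ_ℓ) : E]` (tree `exists_prime_dvd_finrank_cyclotomicField`, Dirichlet; Galois over `F` by
`isGalois_cyclotomicField_of_isGalois`), realised inside `F̄` by `exists_ge_finrank_eq`; for `E = F` take `M = E`.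
This is the input "the indices `(U : V)` are unbounded along the tower" of Milne ADT I Lemma 1.9 / Harari Lemma 16.20
for the open normal subgroups `Gal(F̄/E) ≤ Γ_F`. [cite: MilneADT2006, I Lemma 1.9][cite: Harari2020, Remark 16.3 and Lemma 16.20] -/
theorem exists_ge_finrank_dvd [NumberField F] (E : GalLayer F) :
    ∃ (M : GalLayer F) (h : E ≤ M), Module.finrank F E.1 ∣ (letI := algebraOfLE h; Module.finrank E.1 M.1) := by
  haveI := E.numberField
  haveI := E.isGalois
  by_cases hE : 1 < Module.finrank F E.1
  · obtain ⟨ℓ, hℓp, -, hdvd⟩ := exists_prime_dvd_finrank_cyclotomicField E.1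
      (n := Module.finrank F E.1) Module.finrank_pos.ne'
    haveI : NeZero ℓ := ⟨hℓp.ne_zero⟩
    haveI : NumberField (CyclotomicField ℓ E.1) := IsCyclotomicExtension.numberField {ℓ} E.1 (CyclotomicField ℓ E.1)
    haveI : FiniteDimensional F (CyclotomicField ℓ E.1) :=
      Module.Finite.trans E.1 (CyclotomicField ℓ E.1)
    haveI : IsGalois F (CyclotomicField ℓ E.1) := isGalois_cyclotomicField_of_isGalois ℓ hE
    obtain ⟨M, h, hM⟩ := exists_ge_finrank_eq E (CyclotomicField ℓ E.1)
    exact ⟨M, h, hM ▸ hdvd⟩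
  · refine ⟨E, le_rfl, ?_⟩
    have h1 : Module.finrank F E.1 = 1 := by
      have h0 : 0 < Module.finrank F E.1 := Module.finrank_pos
      omega
    rw [h1]
    exact one_dvd _

end GalLayer

end IdeleClassBar

end Literature.NumberTheory.GaloisRepresentations

end
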